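import Literature.AlgebraicGeometry.AbelianSchemes.WeilUnitOfTorsionPoint
import Literature.AlgebraicGeometry.RelativeSpec.DiscrepancyInvariantSection
import Literature.AlgebraicGeometry.RelativeSpec.DescentOfUnitAlongFreeQuotient
import HarnessLib

/-!
# A trivial Weil unit makes the generator of `[n]^* L_ŷ` invariant under the translation ([Mumford AV] §20 p. 184; §15 Thm. 1, proof)

Topic `Literature/AlgebraicGeometry/AbelianSchemes`; namespace `Literature.AlgebraicGeometry.AbelianSchemes.AbelianSchemeOver.DualPair`.  THEOREMS ONLY;
no definition, no named fact, no instance, no notation, no `sorry`.  Cell `hodgecm-mathlib` (D-0151), FLOOR 0, P6 «MOD programme» (crux hLiu418 =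
stmt-HodgeConjecture-24832), W-line letter `stub_W1` «WeilPairingNatural», σ1 road (memo `F0/P6/B-p08/g32/ROAD-sigma1-WeilPairingNatural.v1.B-p08g32.md`),
organ (σ1-d2) step (E1′) «INVARIANT GENERATOR» — the section-level form of «`e_n(x, ŷ) = 1`» that the coface computation of (σ1-d2) consumes (★
p846762 `WeilUnitNondegeneracyOfCofaces.eq_one_of_cofaces_agree` then gives `ŷ = 1`).  Over ★ p846716 `WeilUnitOfTorsionPoint` (`weilUnit`, `eq_weilUnit`), ★
`TorsionSectionPairing.existsUnique_pairingUnit`, ★ `RelativeSpec/DiscrepancyInvariantSection` (the discrepancy equation on sections) and ★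
`RelativeSpec/DescentOfUnitAlongFreeQuotient` (pulled-back sections are invariant).  HC_CM is proved only modulo the printed citations until rung 0 closes;
nothing here is about HC.

THE PRINT.  [MumfordAV1970] §20 p. 184: for `L ∈ Pic⁰(X)` of order `n` and a trivialisation `ψ : n_X^* L ≅ 𝒪_X`, translation by `x ∈ X_n` acts on `ψ` through
the scalar `e_n(x, L)`; so `e_n(x, L) = 1` says that the generator `ψ⁻¹(1)` is FIXED by the canonical action of `t_x` on the sections of `n_X^* L` —
the descent datum of `L` along the `X_n`-torsor `n_X` is trivial at `x` (§15 Thm. 1, proof).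

WHAT IS HERE (setting of ★ `weilUnit`: `A/S` abelian with commutative law, `S` reduced locally Noetherian, `D = (Â, 𝒫)` + `hD`, `f : T → S`, `T` locally
Noetherian, `c` an `n`-torsion `T`-point of `Â`, `ρ :=` ★ `translationActionMulN` of `A_T`, `L_c := (1 × c)^*𝒫`):
* `discrepancy_eq_weilUnit` — for ANY trivialisation `e : [n]^* L_c ≅ [n]^* 𝒪` and any `x`, the discrepancy equation of `e` at `x` holds with the scalar
  `[n]^♯ π^♯ (weilUnit … x)` (★ `existsUnique_pairingUnit` + ★ `eq_weilUnit`);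
* **`actSections_generator_eq_self_of_weilUnit_eq_one`** — if `weilUnit … x = 1` then the generator `s := e⁻¹(η_{[n]}(1))` of `[n]^* L_c` satisfies
  `x · s = s` for the canonical action ★ `actSections` of the translation `t_x` (★ `EquivariantStructure.ofPullback ρ L_c`).

## References
* [MumfordAV1970] D. Mumford, *Abelian Varieties* (1970), §20 (p. 184), §15 Thm. 1 (p. 143), §12 Thm. 1 (p. 112).
* [MumfordFogartyKirwan1994] D. Mumford, J. Fogarty, F. Kirwan, *Geometric Invariant Theory*, 3rd ed. (1994), Ch. 1 §3 Def. 1.6 (p. 30).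
-/

set_option autoImplicit false

noncomputable section

-- `TopCat.Presheaf`/`Scheme.Modules` are not reducible (as in ★ `TorsionSectionPairing`, ★ `DiscrepancyInvariantSection`).
set_option backward.isDefEq.respectTransparency false

universe u

open CategoryTheory CategoryTheory.Limits AlgebraicGeometry MonoidalCategory CartesianMonoidalCategory TopologicalSpace Opposite
open scoped MonObj

namespace Literature.AlgebraicGeometry.AbelianSchemes.AbelianSchemeOver.DualPair

open Literature.AlgebraicGeometry.RelativeSpec Literature.AlgebraicGeometry.Modules Literature.AlgebraicGeometry.RelativeSpec.ActionOver
  TorsionPairing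

variable {S : Scheme.{u}} {A : AbelianSchemeOver S} [IsReduced S] [IsLocallyNoetherian S] (D : A.DualPair)
  (hD : Nonempty ((Scheme.Modules.pullback (DualPair.unitHatSlice D)).obj D.P ≅ SheafOfModules.unit _)) (n : ℕ)
  {T : Scheme.{u}} (f : T ⟶ S) [IsLocallyNoetherian T] [IsCommMonObj (A.baseChange f).X] (c : Over.mk f ⟶ D.hat.X) (hc : c ^ n = 1)
  (e : (Scheme.Modules.pullback ((A.baseChange f).mulN n).left).obj (D.pullbackP f c.left (Over.w c)) ≅
    (Scheme.Modules.pullback ((A.baseChange f).mulN n).left).obj (SheafOfModules.unit (A.baseChange f).X.left.ringCatSheaf))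

/-- **The discrepancy scalar of ANY trivialisation `e` of `[n]^* L_c` at `x` is `[n]^♯ π^♯ e_n(x, ŷ)`** (★ `existsUnique_pairingUnit` gives a scalar, ★
`eq_weilUnit` identifies it). [cite: MumfordAV1970, §20 (p. 184)] -/
theorem discrepancy_eq_weilUnit (x : (A.baseChange f).torsionSections n) :
    (Scheme.Modules.pullback (((A.baseChange f).translationActionMulN n).autHom x)).map e.hom ≫
        ((EquivariantStructure.ofPullback ((A.baseChange f).translationActionMulN n)
          (SheafOfModules.unit (A.baseChange f).X.left.ringCatSheaf)).iso x).hom =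
      ((EquivariantStructure.ofPullback ((A.baseChange f).translationActionMulN n) (D.pullbackP f c.left (Over.w c))).iso x).hom ≫ e.hom ≫
        globalScalar _ (((A.baseChange f).mulN n).left.appTop ((A.baseChange f).X.hom.appTop (D.weilUnit hD n f c hc x))) := by
  obtain ⟨r, hr, -⟩ := existsUnique_pairingUnit (A.baseChange f) ((A.baseChange f).translationActionMulN n) (D.pullbackP f c.left (Over.w c)) e x
  rw [← D.eq_weilUnit hD n f c hc e x r hr]
  exact hr

/-- **INVARIANT GENERATOR**: if `e_n(x, ŷ) = 1` then the generator `s := e⁻¹(η_{[n]}(1))` of `[n]^* L_c` is FIXED by `x`: `x · s = s` for the canonical action of the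
translation `t_x` on the sections of `[n]^* L_c` (★ `actSections` of ★ `EquivariantStructure.ofPullback`).  Proof: the discrepancy equation on sections (★
`actSections_app_eq_smul_of_discrepancy`) at `t := s` reads `x · e(s) = e(x · s)` (scalar `1`), `e(s) = η(1)` is a pulled-back section hence invariant (★
`actSections_unitSection_ofPullback`), and `e` is injective on sections. [cite: MumfordAV1970, §20 (p. 184)] [cite: MumfordAV1970, §15 Thm. 1 (p. 143)]
[cite: MumfordFogartyKirwan1994, Ch. 1 §3 Def. 1.6 (p. 30)] -/
theorem actSections_generator_eq_self_of_weilUnit_eq_one (x : (A.baseChange f).torsionSections n) (hx : D.weilUnit hD n f c hc x = 1) :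
    ((A.baseChange f).translationActionMulN n).actSections _
        (EquivariantStructure.ofPullback ((A.baseChange f).translationActionMulN n) (D.pullbackP f c.left (Over.w c))).iso x ⊤
        (e.inv.app (((A.baseChange f).mulN n).left ⁻¹ᵁ ⊤)
          (Literature.AlgebraicGeometry.Modules.unitSection ((A.baseChange f).mulN n).left (SheafOfModules.unit (A.baseChange f).X.left.ringCatSheaf) ⊤ (1 : Γ((A.baseChange f).X.left, ⊤)))) =
      e.inv.app (((A.baseChange f).mulN n).left ⁻¹ᵁ ⊤)
        (Literature.AlgebraicGeometry.Modules.unitSection ((A.baseChange f).mulN n).left (SheafOfModules.unit (A.baseChange f).X.left.ringCatSheaf) ⊤ (1 : Γ((A.baseChange f).X.left, ⊤))) := by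
  have hdisc := D.discrepancy_eq_weilUnit hD n f c hc e x
  rw [hx, map_one, map_one] at hdisc
  -- the discrepancy equation on the section `s := e⁻¹(η 1)`
  have hsec := actSections_app_eq_smul_of_discrepancy ((A.baseChange f).translationActionMulN n) _ _ e x 1 hdisc ⊤
    (e.inv.app (((A.baseChange f).mulN n).left ⁻¹ᵁ ⊤)
      (Literature.AlgebraicGeometry.Modules.unitSection ((A.baseChange f).mulN n).left (SheafOfModules.unit (A.baseChange f).X.left.ringCatSheaf) ⊤ (1 : Γ((A.baseChange f).X.left, ⊤))))
  -- `e (e⁻¹ (η 1)) = η 1`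
  have hinv : e.hom.app (((A.baseChange f).mulN n).left ⁻¹ᵁ ⊤)
      (e.inv.app (((A.baseChange f).mulN n).left ⁻¹ᵁ ⊤)
        (Literature.AlgebraicGeometry.Modules.unitSection ((A.baseChange f).mulN n).left (SheafOfModules.unit (A.baseChange f).X.left.ringCatSheaf) ⊤ (1 : Γ((A.baseChange f).X.left, ⊤)))) =
      Literature.AlgebraicGeometry.Modules.unitSection ((A.baseChange f).mulN n).left (SheafOfModules.unit (A.baseChange f).X.left.ringCatSheaf) ⊤ (1 : Γ((A.baseChange f).X.left, ⊤)) := by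
    rw [← CategoryTheory.comp_apply, ← Scheme.Modules.Hom.comp_app, Iso.inv_hom_id, Scheme.Modules.Hom.id_app]
    rfl
  rw [hinv, actSections_unitSection_ofPullback, map_one, one_smul] at hsec
  -- `η 1 = e (x · s)` ⇒ apply `e⁻¹`
  have h := congrArg (e.inv.app (((A.baseChange f).mulN n).left ⁻¹ᵁ ⊤)) hsec
  rw [← CategoryTheory.comp_apply (e.hom.app _), ← Scheme.Modules.Hom.comp_app, Iso.hom_inv_id, Scheme.Modules.Hom.id_app] at h
  exact h.symm

end Literature.AlgebraicGeometry.AbelianSchemes.AbelianSchemeOver.DualPair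

end
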